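import Literature.MathematicalPhysics.QuantumFieldTheory.Balaban1983to89.B7Prop4FlatCurlTransportRec
import Literature.MathematicalPhysics.QuantumFieldTheory.Balaban1983to89.B7Prop4GeneralLevelsRec

/-!
# `Balaban1983to89.B7Prop4FlatCarriedLetterRec` — THE FLAT CARRIED GAUGE LETTER `Θ_j` OF THE RECORD's LINEARISED AVERAGING ([Balaban1987RG1] (0.4)): the identity
# `L^jηQ_j(1)B = Ŷ_j + dΘ_j(B)` with `Ŷ_j =` print's straight iterate (127)∕(125), the LOCAL (two-block-box ∕ `|·|₁`-ball) curl transport, and the curvature bound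
# `‖Θ_j(B)‖ ≤ (d·s)²·Σ_{i<j} L^{2i}·M` (global and local) — the data term of route (a) at [Balaban1985RegularSpaces] (1.56)–(1.57) (director-ym №266∕№269)

statement-level skeleton of published theorems with citation tags; proofs where landed; nothing here is a claim about the Yang–Mills mass gap

CITATION HEADER (lean-in-tree rule).  Cell `pub-ymgap`, seat `pub-ymgap-dag-n05-e` g37 (N05-REC LEAD PEN); item R1 ([3] layer), road (A′), NOTE-157 route (a) follow-ups (i) of director-ym
№269 (1)∕(3): the companion of `B7Prop4FlatCurlTransportRec` (S10).  `--kind proof --supports stmt-QuantumFields-20541` (K0⁷; count-neutral; no definition).  Sources READ: [3] =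
[Balaban1985Averaging] pp. 24–25 (47)–(50), p. 31 (93), p. 36 (122)–(126), pp. 37–38 (127)–(133) (`paper:balaban1985-cmp98-averaging`); [6] = [Balaban1985RegularSpaces] p. 86 (1.56)–(1.57);
[I] = [Balaban1987RG1] (0.3)–(0.4) pp. 252–253.  REUSED BY NAME: `B7Prop4FlatCurlTransportRec.{asum_plaqWord_linQZ_rescale, norm_curl_linQIterZ_le}`, `B7Prop3StaircaseStokesRec.{norm_asum_rectWord_le,
norm_PhiZ_le, norm_PhiZ_le_global}` (flat Stokes, the curvature bound of `Φ`), `B7Prop4GaugeInductionRec.{qhatIter, carryIter, linIter_eq_qhat_add_gauge}` (the exact split of the linear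
iterate), `B7Prop3GaugeCarryRec.{QhatZ, lamZ, dcovZ, QhatZ_one_left, lamZ_one_left, linQcovZ_one_left, linQcovZ_eq_QhatZ_add_dcovZ, lamZ_sub}`, `B7Prop3PureGaugeRec.{dcovF, rlamZ_eq,
QhatZ_dcovF_add}`, `B7Prop4GeneralLevelsRec.{dcovF_succ_eq_dcovZ, QhatZ_sub, dcovF_sub, norm_dcovF_le, norm_rlamZ_le}`, `BlockAveragingZd.{avgIterZ_one, WZ_one, l1_offZ_le}`,
`B7SectEFLinearisationRec.{linQZ, linQIterZ, linCovIterZ, rlamZ}`.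

WHAT IS PROVED (sorry-free; `L = 2s + 1` odd where centred blocks enter).  §1 LOCAL CURL TRANSPORT (the two-block-box edition of S10, in the `|·|₁`-ball currency of
`B7Prop3StaircaseStokesRec` §3): ★`norm_asum_plaqWord_linQZ_rescale_le_loc` — `‖(L·Q₀Y)(∂P_z)‖ ≤ L²·M` needs the fine curl bound `M` only within `|·|₁`-distance `d·s + 2L` of `Lz`;
★★`norm_curl_linQIterZ_le_loc` — `‖Ŷ_j(∂P_z)‖ ≤ L^{2j}·M` needs `‖B(∂p)‖ ≤ M` only for `|p − y|₁ ≤ R` whenever `|L^jz − y|₁ + (d·s + 2L)·L^j ≤ R` (margin constant `d·s + 2L` per unit of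
scale).  §2 THE FLAT CARRIED LETTER in RECURSION CURRENCY (`Θ₀ = 0`, `Θ_{j+1}(z) = (R̄Θ_j)(Lz) + Φ_{Ŷ_j}(Lz)`, `Ŷ_j = linQIterZ L B j`; any `Θ` obeying these two equations):
★`norm_rlamZ_le_loc` (the block mean reads the block only); ★★★`norm_carried_flat_le` — GLOBAL curvature bound `‖Θ_j(z)‖ ≤ (d·s)²·M·Σ_{i<j}(L²)^i`; ★★★`norm_carried_flat_le_loc` — the same
from the LOCAL curl bound within `|·|₁`-radius `R` of `y` whenever `|L^jz − y|₁ + (d·s + 2L)·L^j ≤ R`; `norm_sub_carried_flat_le` — hence `‖Θ_j(x) − Θ_j(x + e_ν)‖ ≤ 2·(d·s)²·M·Σ_{i<j}(L²)^i`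
(the size of the data shift `dΘ_j(A)` of route (a)).  §3 THE CANONICAL INSTANCE AND THE IDENTITY AT `U₀ = 1`: `qhatIter_one_eq_linQIterZ` (`Ŷ_j = linQIterZ` — the `Q̂(1) = L·Q₀` of
`QhatZ_one_left` iterated), `carryIter_one_zero ∕ carryIter_one_succ` (the lineage's `carryIter` at the flat background obeys §2's recursion with `G_j = Φ`), ★★★`linCovIterZ_one_eq` —
**`L^jηQ_j(1)B = linQIterZ L B j + d(Θ_j(B))` EXACTLY** (`Θ_j =` the canonical carried letter; `d` the plain difference), and its first level `linCovIterZ_one_one` — `= L·Q₀B + Φ_B(c₋) − Φ_B(c₊)`.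
This is the positive form of the DO-NOT-REKEY rule (director-ym №269 (3)): the engine's `map_linCovIter_flat ∕ linCovIter_one_left` shape holds for `Ŷ_j`, and for `linCovIterZ` only up to `dΘ_j`.
HONEST SCOPE.  Flat abelian-linear bookkeeping (Stokes sums, block means, finite-range dependence); nothing of [3]∕[6]∕[I] asserted; `HThm4Rec` UNDISCHARGED; N05 discharged of record
untouched; N07 not claimable; counts unmoved (typed 28∕28 · discharged 8∕28); one finite 𝕋⁴ programme at fixed ε — nothing continuum ∕ ℝ⁴ ∕ OS ∕ mass gap ∕ Clay.  No `def`, no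
`instance`, no `notation`, no `sorry`.
-/

set_option autoImplicit false

noncomputable section

open scoped BigOperators
open Finset

namespace Literature.MathematicalPhysics.QuantumFieldTheory.Balaban1983to89.B7Prop4FlatCarriedLetterRec

open B7Prop1Explicit hiding Site
open B7Prop1Explicit renaming Site → SiteZ
open B7Eq78Linearization (conjR conjR_apply)
open B7Prop3GeneralRotated (norm_conjR_le)
open BlockAveragingZd (offZ IdxZ WZ WZ_one avgIterZ avgIterZ_one l1_offZ_le)
open B7SectEFLinearisationRec (linQZ linQIterZ linQIterZ_zero linQIterZ_succ linQcovZ linCovIterZ linCovIterZ_zero linCovIterZ_succ rlamZ)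
open B7Prop3FlatRecSide (PhiZ)
open B7Prop3StaircaseStokesRec (norm_asum_rectWord_le norm_PhiZ_le norm_PhiZ_le_global)
open B7Prop4FlatCurlTransportRec (asum_plaqWord_linQZ_rescale norm_curl_linQIterZ_le)
open B7Prop3GaugeCarryRec (lamZ dcovZ QhatZ dcovZ_apply QhatZ_one_left lamZ_one_left linQcovZ_one_left linQcovZ_eq_QhatZ_add_dcovZ lamZ_sub)
open B7Prop3PureGaugeRec (dcovF dcovF_apply rlamZ_eq QhatZ_dcovF_add)
open B7Prop4GaugeInductionRec (qhatIter carryIter qhatIter_zero qhatIter_succ carryIter_zero carryIter_succ linIter_eq_qhat_add_gauge)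
open B7Prop4GeneralLevelsRec (dcovF_succ_eq_dcovZ QhatZ_sub dcovF_sub norm_dcovF_le norm_rlamZ_le)

variable {d : ℕ}

/-! ## §0 Arithmetic of the `|·|₁`-margins -/

section Arith

/-- `|n·v|₁ = n·|v|₁` for a natural multiple. [cite: Balaban1985Averaging, p.24 (bookkeeping of the block geometry)] -/
theorem l1_natCast_zsmul (n : ℕ) (v : SiteZ d) : l1 ((n : ℤ) • v) = n * l1 v := by
  unfold l1
  rw [Finset.mul_sum]
  refine Finset.sum_congr rfl fun κ _ => ?_
  rw [Pi.smul_apply, smul_eq_mul, Int.natAbs_mul, Int.natAbs_natCast]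

/-- the `|·|₁`-triangle inequality through an intermediate point. [cite: Balaban1985Averaging, p.24 (bookkeeping)] -/
theorem l1_sub_le_of_mid (u v w : SiteZ d) : l1 (u - w) ≤ l1 (u - v) + l1 (v - w) := by
  have e1 : u - w = (u - v) + (v - w) := by abel
  rw [e1]; exact l1_add_le _ _

/-- **Scale transport of the margin**: a point `x` within `|·|₁`-distance `ρ` of `Lz` on the `j`-th lattice sits, after `j` rescalings, within `L^j·ρ` of `L^{j+1}z`:
`|L^jx − y|₁ ≤ L^j·ρ + |L^{j+1}z − y|₁`. [cite: Balaban1985Averaging, p.24 (sentence after (43)), (127) p.37] -/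
theorem l1_pow_smul_sub_le (L j ρ : ℕ) (x z y : SiteZ d) (hx : l1 (x - (L : ℤ) • z) ≤ ρ) :
    l1 (((L : ℤ) ^ j) • x - y) ≤ L ^ j * ρ + l1 (((L : ℤ) ^ (j + 1)) • z - y) := by
  have h1 := l1_sub_le_of_mid (((L : ℤ) ^ j) • x) (((L : ℤ) ^ (j + 1)) • z) y
  have h2 : ((L : ℤ) ^ j) • x - ((L : ℤ) ^ (j + 1)) • z = (((L ^ j : ℕ) : ℤ)) • (x - (L : ℤ) • z) := by
    rw [smul_sub, pow_succ, ← smul_smul, Nat.cast_pow]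
  rw [h2, l1_natCast_zsmul] at h1
  calc l1 (((L : ℤ) ^ j) • x - y) ≤ L ^ j * l1 (x - (L : ℤ) • z) + l1 (((L : ℤ) ^ (j + 1)) • z - y) := h1
    _ ≤ L ^ j * ρ + l1 (((L : ℤ) ^ (j + 1)) • z - y) := by gcongr

/-- The margin bookkeeping of the induction over the levels: `|L^{j+1}z − y|₁ + ρ·L^{j+1} ≤ R`, `|x − Lz|₁ ≤ ρ′ ≤ ρ`, `L ≥ 2` ⇒ `|L^jx − y|₁ + ρ·L^j ≤ R`.
[cite: Balaban1985Averaging, p.24 (sentence after (43)), (127) p.37] -/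
theorem margin_step {L : ℕ} (hL : 2 ≤ L) (j ρ ρ' R : ℕ) (hρ : ρ' ≤ ρ) (x z y : SiteZ d) (hx : l1 (x - (L : ℤ) • z) ≤ ρ')
    (hz : l1 (((L : ℤ) ^ (j + 1)) • z - y) + ρ * L ^ (j + 1) ≤ R) : l1 (((L : ℤ) ^ j) • x - y) + ρ * L ^ j ≤ R := by
  have h1 := l1_pow_smul_sub_le L j ρ' x z y hx
  have h2 : L ^ j * ρ' ≤ L ^ j * ρ := Nat.mul_le_mul_left _ hρ
  have h3 : 2 * (ρ * L ^ j) ≤ ρ * L ^ (j + 1) := by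
    rw [pow_succ]
    have : ρ * L ^ j * 2 ≤ ρ * L ^ j * L := Nat.mul_le_mul_left _ hL
    linarith [this]
  have h4 : L ^ j * ρ = ρ * L ^ j := Nat.mul_comm _ _
  omega

end Arith

/-! ## §1 The LOCAL flat curl transport: the two-block-box edition of `B7Prop4FlatCurlTransportRec` -/

section LocalCurl

variable {𝔸 : Type*} [NormedRing 𝔸] [NormedAlgebra ℂ 𝔸] (L : ℕ)

/-- ★ **`‖(L·Q₀Y)(∂P_z)‖ ≤ L²·M` FROM A LOCAL CURL BOUND**: the coarse plaquette of the rescaled straight average is the block mean of the boundary sums of the translated `L × L` squares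
`[Lz + o_r; Le_μ × Le_ν]` (`asum_plaqWord_linQZ_rescale`), all of whose plaquettes lie within `|·|₁`-distance `d·s + 2(L−1) < d·s + 2L` of `Lz` (`|o_r|₁ ≤ d·s` on centred blocks,
`L = 2s+1`); so the fine bound `‖Y(∂p)‖ ≤ M` is needed only for `|p − y|₁ ≤ R` when `|Lz − y|₁ + d·s + 2L ≤ R` — the two-block box `B(∂P)` of [3] p. 24 in ball currency.
[cite: Balaban1985Averaging, (48)–(50) pp.24–25, (125) p.36, p.24 (sentence after (43))] -/
theorem norm_asum_plaqWord_linQZ_rescale_le_loc {s : ℕ} (hLs : L = 2 * s + 1) (Y : SiteZ d → Fin d → 𝔸) {M : ℝ} (y : SiteZ d) (R : ℕ)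
    (hM : ∀ (x : SiteZ d) (μ ν : Fin d), l1 (x - y) ≤ R → ‖asum Y x (plaqWord μ ν)‖ ≤ M)
    (z : SiteZ d) (μ ν : Fin d) (hz : l1 ((L : ℤ) • z - y) + (d * s + 2 * L) ≤ R) :
    ‖asum (fun w κ => linQZ L Y ((L : ℤ) • w) κ) z (plaqWord μ ν)‖ ≤ (L : ℝ) ^ 2 * M := by
  have hL : 1 ≤ L := by omega
  rw [asum_plaqWord_linQZ_rescale]
  have hterm : ∀ r : Fin d → Fin L, ‖asum Y ((L : ℤ) • z + offZ L r) (rectWord L L μ ν)‖ ≤ (L : ℝ) ^ 2 * M := fun r => by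
    have hor : l1 (offZ L r) ≤ d * s := l1_offZ_le hLs r
    have h := norm_asum_rectWord_le Y y R hM ((L : ℤ) • z + offZ L r) L L μ ν
      (fun i hi j hj => by
        have e1 : (L : ℤ) • z + offZ L r + (i : ℤ) • e μ + (j : ℤ) • e ν - y = ((L : ℤ) • z - y) + (offZ L r + ((i : ℤ) • e μ + (j : ℤ) • e ν)) := by abel
        rw [e1]
        have h2 : l1 (offZ L r + ((i : ℤ) • e μ + (j : ℤ) • e ν)) ≤ d * s + (i + j) := by
          calc l1 (offZ L r + ((i : ℤ) • e μ + (j : ℤ) • e ν)) ≤ l1 (offZ L r) + l1 ((i : ℤ) • e μ + (j : ℤ) • e ν) := l1_add_le _ _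
            _ ≤ d * s + (l1 ((i : ℤ) • e μ) + l1 ((j : ℤ) • e ν)) := add_le_add hor (l1_add_le _ _)
            _ = d * s + (i + j) := by rw [l1_zsmul_e, l1_zsmul_e]; simp
        calc l1 (((L : ℤ) • z - y) + (offZ L r + ((i : ℤ) • e μ + (j : ℤ) • e ν)))
            ≤ l1 ((L : ℤ) • z - y) + l1 (offZ L r + ((i : ℤ) • e μ + (j : ℤ) • e ν)) := l1_add_le _ _
          _ ≤ l1 ((L : ℤ) • z - y) + (d * s + (i + j)) := add_le_add le_rfl h2
          _ ≤ R := by omega)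
    calc ‖asum Y ((L : ℤ) • z + offZ L r) (rectWord L L μ ν)‖ ≤ (L : ℝ) * L * M := h
      _ = (L : ℝ) ^ 2 * M := by ring
  calc ‖∑ r : Fin d → Fin L, (((L : ℝ) ^ d)⁻¹) • asum Y ((L : ℤ) • z + offZ L r) (rectWord L L μ ν)‖
      ≤ ∑ r : Fin d → Fin L, ‖(((L : ℝ) ^ d)⁻¹) • asum Y ((L : ℤ) • z + offZ L r) (rectWord L L μ ν)‖ := norm_sum_le _ _
    _ ≤ ∑ _r : Fin d → Fin L, (((L : ℝ) ^ d)⁻¹) * ((L : ℝ) ^ 2 * M) := Finset.sum_le_sum fun r _ => by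
        rw [norm_smul, Real.norm_of_nonneg (by positivity)]
        exact mul_le_mul_of_nonneg_left (hterm r) (by positivity)
    _ = (L : ℝ) ^ 2 * M := by
        rw [Finset.sum_const, Finset.card_univ, nsmul_eq_mul, Fintype.card_fun, Fintype.card_fin, Fintype.card_fin]
        have hL0 : (L : ℝ) ≠ 0 := by exact_mod_cast (by omega : L ≠ 0)
        push_cast
        field_simp

/-- ★★ **THE LOCAL CURL TRANSPORT OVER THE LEVELS**: `‖Ŷ_j(∂P_z)‖ ≤ L^{2j}·M` for the straight iterate `Ŷ_j = linQIterZ L B j`, from the fine curl bound `‖B(∂p)‖ ≤ M` on the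
`|·|₁`-ball of radius `R` about `y` only, whenever `|L^jz − y|₁ + (d·s + 2L)·L^j ≤ R` — the finite-range dependence of (127) («this definition is local», [3] p. 24) for the curls that bound the
carried letter in route (a). [cite: Balaban1985Averaging, (127) p.37, (125) p.36, (48)–(50) pp.24–25, p.24 (sentence after (43)); Balaban1985RegularSpaces, (1.56)–(1.57) p.86] -/
theorem norm_curl_linQIterZ_le_loc {s : ℕ} (hLs : L = 2 * s + 1) (hs : 1 ≤ s) (B : SiteZ d → Fin d → 𝔸) {M : ℝ} (y : SiteZ d) (R : ℕ)
    (hM : ∀ (x : SiteZ d) (μ ν : Fin d), l1 (x - y) ≤ R → ‖asum B x (plaqWord μ ν)‖ ≤ M) :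
    ∀ (j : ℕ) (z : SiteZ d) (μ ν : Fin d), l1 (((L : ℤ) ^ j) • z - y) + (d * s + 2 * L) * L ^ j ≤ R →
      ‖asum (linQIterZ L B j) z (plaqWord μ ν)‖ ≤ ((L : ℝ) ^ 2) ^ j * M
  | 0, z, μ, ν, hz => by
    have h0 : l1 (z - y) ≤ R := by
      have : l1 (((L : ℤ) ^ 0) • z - y) = l1 (z - y) := by rw [pow_zero, one_smul]
      omega
    simpa using hM z μ ν h0
  | j + 1, z, μ, ν, hz => by
    have hL2 : 2 ≤ L := by omega
    have ih : ∀ (x : SiteZ d) (μ' ν' : Fin d), l1 (x - (L : ℤ) • z) ≤ d * s + 2 * L →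
        ‖asum (linQIterZ L B j) x (plaqWord μ' ν')‖ ≤ ((L : ℝ) ^ 2) ^ j * M := fun x μ' ν' hx =>
      norm_curl_linQIterZ_le_loc hLs hs B y R hM j x μ' ν' (margin_step hL2 j _ _ R le_rfl x z y hx hz)
    have h := norm_asum_plaqWord_linQZ_rescale_le_loc L hLs (linQIterZ L B j) ((L : ℤ) • z) (d * s + 2 * L) ih z μ ν (by simp [l1])
    have e : (linQIterZ L B (j + 1)) = fun w κ => linQZ L (linQIterZ L B j) ((L : ℤ) • w) κ := rfl
    rw [e]
    calc ‖asum (fun w κ => linQZ L (linQIterZ L B j) ((L : ℤ) • w) κ) z (plaqWord μ ν)‖ ≤ (L : ℝ) ^ 2 * (((L : ℝ) ^ 2) ^ j * M) := h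
      _ = ((L : ℝ) ^ 2) ^ (j + 1) * M := by ring

end LocalCurl

/-! ## §2 The flat carried letter in recursion currency: `Θ₀ = 0`, `Θ_{j+1}(z) = (R̄Θ_j)(Lz) + Φ_{Ŷ_j}(Lz)` -/

section Carried

variable {𝔸 : Type*} [NormedRing 𝔸] [NormedAlgebra ℂ 𝔸] [NormOneClass 𝔸] (L : ℕ)

omit [NormedAlgebra ℂ 𝔸] in
/-- The flat background is `U1`-valued. [cite: Balaban1985Averaging, (44) p.24 (bookkeeping)] -/
theorem one_mem_U1Z (x : SiteZ d) (κ : Fin d) : (1 : SiteZ d → Fin d → 𝔸ˣ) x κ ∈ U1 𝔸 := Subgroup.one_mem _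

/-- ★ **The rotated block mean reads the block only**: `‖(R̄θ)(y)‖ ≤ m` as soon as `‖θ(y + o_r)‖ ≤ m` at the `L^d` centred block points (`V₀ ∈ U1`; the local edition of
`B7Prop4GeneralLevelsRec.norm_rlamZ_le`). [cite: Balaban1985Averaging, (78) p.30, p.24 (sentence after (43))] -/
theorem norm_rlamZ_le_loc (hL : 1 ≤ L) {V₀ : SiteZ d → Fin d → 𝔸ˣ} (hV₀ : ∀ x κ, V₀ x κ ∈ U1 𝔸) {θ : SiteZ d → 𝔸} {m : ℝ} (y : SiteZ d)
    (hθ : ∀ r : Fin d → Fin L, ‖θ (y + offZ L r)‖ ≤ m) : ‖rlamZ L V₀ θ y‖ ≤ m := by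
  rw [rlamZ_eq]
  have := B7Eq170Flat.norm_bmean_le (d := d) hL (f := fun r => conjR (hol V₀ y (treeWord (offZ L r))) (θ (y + offZ L r))) (M := m)
    fun r => (norm_conjR_le (hol_mem hV₀ _ _) _).trans (hθ r)
  rwa [B7Eq170Flat.bmean_apply] at this

variable {s : ℕ} (hLs : L = 2 * s + 1) (hs : 1 ≤ s) (B : SiteZ d → Fin d → 𝔸) {M : ℝ} (hM0 : 0 ≤ M)
  (Θ : ℕ → SiteZ d → 𝔸) (hΘ0 : Θ 0 = 0)
  (hΘs : ∀ (j : ℕ) (z : SiteZ d), Θ (j + 1) z = rlamZ L (1 : SiteZ d → Fin d → 𝔸ˣ) (Θ j) ((L : ℤ) • z) + PhiZ L (linQIterZ L B j) ((L : ℤ) • z))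

include hLs hM0 hΘ0 hΘs in
/-- ★★★ **THE CURVATURE BOUND OF THE FLAT CARRIED LETTER (GLOBAL)**: if `‖B(∂p)‖ ≤ M` at every fine plaquette, then `‖Θ_j(B)(z)‖ ≤ (d·s)²·M·Σ_{i<j} (L²)^i` at every level `j` and
coarse site `z` — the block mean `R̄` (here the plain mean) does not increase the sup, and the letter added at level `i` is `Φ_{Ŷ_i}` with `‖Φ_{Ŷ_i}‖ ≤ (d·s)²·L^{2i}·M`
(`norm_PhiZ_le_global ∘ norm_curl_linQIterZ_le`).  The carried letter is controlled by the CURVATURE of `B`, not by `sup|B|` (route (a): `dΘ_j(A)` is data, small by (1.40)).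
[cite: Balaban1985Averaging, (93) p.31, (124)–(126) p.36, (127)–(128) p.37; Balaban1987RG1, (0.4) p.253; Balaban1985RegularSpaces, (1.56)–(1.57) p.86] -/
theorem norm_carried_flat_le (hM : ∀ (x : SiteZ d) (μ ν : Fin d), ‖asum B x (plaqWord μ ν)‖ ≤ M) :
    ∀ (j : ℕ) (z : SiteZ d), ‖Θ j z‖ ≤ ((d : ℝ) * s) ^ 2 * M * ∑ i ∈ range j, ((L : ℝ) ^ 2) ^ i
  | 0, z => by simp [hΘ0]
  | j + 1, z => by
    have hL : 1 ≤ L := by omega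
    have ih : ∀ w : SiteZ d, ‖Θ j w‖ ≤ ((d : ℝ) * s) ^ 2 * M * ∑ i ∈ range j, ((L : ℝ) ^ 2) ^ i := fun w => norm_carried_flat_le hM j w
    have hcurl : ∀ (x : SiteZ d) (μ ν : Fin d), ‖asum (linQIterZ L B j) x (plaqWord μ ν)‖ ≤ ((L : ℝ) ^ 2) ^ j * M := norm_curl_linQIterZ_le L hL B hM j
    have hPhi := norm_PhiZ_le_global L (linQIterZ L B j) (by positivity) hcurl hLs ((L : ℤ) • z)
    have hR := norm_rlamZ_le L hL one_mem_U1Z ih ((L : ℤ) • z)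
    rw [hΘs j z, sum_range_succ]
    calc ‖rlamZ L 1 (Θ j) ((L : ℤ) • z) + PhiZ L (linQIterZ L B j) ((L : ℤ) • z)‖
        ≤ ‖rlamZ L 1 (Θ j) ((L : ℤ) • z)‖ + ‖PhiZ L (linQIterZ L B j) ((L : ℤ) • z)‖ := norm_add_le _ _
      _ ≤ ((d : ℝ) * s) ^ 2 * M * ∑ i ∈ range j, ((L : ℝ) ^ 2) ^ i + ((d : ℝ) * s) ^ 2 * (((L : ℝ) ^ 2) ^ j * M) := add_le_add hR hPhi
      _ = ((d : ℝ) * s) ^ 2 * M * (∑ i ∈ range j, ((L : ℝ) ^ 2) ^ i + ((L : ℝ) ^ 2) ^ j) := by ring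

include hLs hs hM0 hΘ0 hΘs in
/-- ★★★ **THE CURVATURE BOUND OF THE FLAT CARRIED LETTER (LOCAL)**: the same bound `‖Θ_j(B)(z)‖ ≤ (d·s)²·M·Σ_{i<j}(L²)^i` from the fine curl bound `‖B(∂p)‖ ≤ M` on the `|·|₁`-ball of
radius `R` about `y` ONLY, whenever `|L^jz − y|₁ + (d·s + 2L)·L^j ≤ R`: the block means read the block tower above `z` and every `Φ_{Ŷ_i}` reads the curls of `Ŷ_i` within `d·s` of its
block centre (`norm_PhiZ_le`), which `norm_curl_linQIterZ_le_loc` transports to the fine lattice — the letter is as local as (127) itself ([3] p. 24). [cite: Balaban1985Averaging, (93) p.31,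
(124)–(126) p.36, (127) p.37, p.24 (sentence after (43)); Balaban1987RG1, (0.3)–(0.4) pp.252–253; Balaban1985RegularSpaces, (1.56)–(1.57) p.86] -/
theorem norm_carried_flat_le_loc (y : SiteZ d) (R : ℕ) (hM : ∀ (x : SiteZ d) (μ ν : Fin d), l1 (x - y) ≤ R → ‖asum B x (plaqWord μ ν)‖ ≤ M) :
    ∀ (j : ℕ) (z : SiteZ d), l1 (((L : ℤ) ^ j) • z - y) + (d * s + 2 * L) * L ^ j ≤ R →
      ‖Θ j z‖ ≤ ((d : ℝ) * s) ^ 2 * M * ∑ i ∈ range j, ((L : ℝ) ^ 2) ^ i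
  | 0, z, _ => by simp [hΘ0]
  | j + 1, z, hz => by
    have hL : 1 ≤ L := by omega
    have hL2 : 2 ≤ L := by omega
    have hds : d * s ≤ d * s + 2 * L := by omega
    -- the block points above `z` and the `d·s`-ball about `Lz` inherit the margin
    have hblock : ∀ r : Fin d → Fin L, ‖Θ j ((L : ℤ) • z + offZ L r)‖ ≤ ((d : ℝ) * s) ^ 2 * M * ∑ i ∈ range j, ((L : ℝ) ^ 2) ^ i := fun r =>
      norm_carried_flat_le_loc y R hM j _ (margin_step hL2 j _ _ R hds _ z y (by rw [add_sub_cancel_left]; exact l1_offZ_le hLs r) hz)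
    have hcurl : ∀ (x : SiteZ d) (μ ν : Fin d), l1 (x - (L : ℤ) • z) ≤ d * s → ‖asum (linQIterZ L B j) x (plaqWord μ ν)‖ ≤ ((L : ℝ) ^ 2) ^ j * M :=
      fun x μ ν hx => norm_curl_linQIterZ_le_loc L hLs hs B y R hM j x μ ν (margin_step hL2 j _ _ R hds x z y hx hz)
    have hPhi := norm_PhiZ_le (linQIterZ L B j) (by positivity : (0 : ℝ) ≤ ((L : ℝ) ^ 2) ^ j * M) ((L : ℤ) • z) (d * s) hcurl L hLs le_rfl
    have hR := norm_rlamZ_le_loc L hL one_mem_U1Z ((L : ℤ) • z) hblock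
    rw [hΘs j z, sum_range_succ]
    calc ‖rlamZ L 1 (Θ j) ((L : ℤ) • z) + PhiZ L (linQIterZ L B j) ((L : ℤ) • z)‖
        ≤ ‖rlamZ L 1 (Θ j) ((L : ℤ) • z)‖ + ‖PhiZ L (linQIterZ L B j) ((L : ℤ) • z)‖ := norm_add_le _ _
      _ ≤ ((d : ℝ) * s) ^ 2 * M * ∑ i ∈ range j, ((L : ℝ) ^ 2) ^ i + ((d : ℝ) * s) ^ 2 * (((L : ℝ) ^ 2) ^ j * M) := add_le_add hR hPhi
      _ = ((d : ℝ) * s) ^ 2 * M * (∑ i ∈ range j, ((L : ℝ) ^ 2) ^ i + ((L : ℝ) ^ 2) ^ j) := by ring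

include hLs hM0 hΘ0 hΘs in
/-- **THE SIZE OF THE DATA SHIFT OF ROUTE (a)**: `‖Θ_j(x) − Θ_j(x + e_ν)‖ ≤ 2·(d·s)²·M·Σ_{i<j}(L²)^i` — the plain coarse gradient `dΘ_j(B)` that route (a) moves into the data `B₁` of
(1.56) («L^jηQ_jA = B₁»: for the record `Q_jA + dΘ_j(A) = B₁`, i.e. print's `Q_j` with data `B₁ − dΘ_j(A)`), bounded by the curvature of `B`. [cite: Balaban1985RegularSpaces, (1.56)–(1.57) p.86;
Balaban1985Averaging, (93) p.31, (124) p.36] -/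
theorem norm_sub_carried_flat_le (hM : ∀ (x : SiteZ d) (μ ν : Fin d), ‖asum B x (plaqWord μ ν)‖ ≤ M) (j : ℕ) (x : SiteZ d) (ν : Fin d) :
    ‖Θ j x - Θ j (x + e ν)‖ ≤ 2 * (((d : ℝ) * s) ^ 2 * M * ∑ i ∈ range j, ((L : ℝ) ^ 2) ^ i) := by
  have h := norm_carried_flat_le L hLs B hM0 Θ hΘ0 hΘs hM j
  exact (norm_sub_le _ _).trans (by linarith [h x, h (x + e ν)])

include hLs hM0 hΘ0 hΘs in
/-- The same in the lineage's covariant-derivative letter at the flat background: `‖(d_1Θ_j)(x, ν)‖ ≤ 2·(d·s)²·M·Σ_{i<j}(L²)^i` (`B7Prop3PureGaugeRec.dcovF` at `V₀ = 1` is the plain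
difference). [cite: Balaban1985Averaging, (55)–(56) p.27, (93) p.31; Balaban1985RegularSpaces, (1.56)–(1.57) p.86] -/
theorem norm_dcovF_carried_flat_le (hM : ∀ (x : SiteZ d) (μ ν : Fin d), ‖asum B x (plaqWord μ ν)‖ ≤ M) (j : ℕ) (x : SiteZ d) (ν : Fin d) :
    ‖dcovF (1 : SiteZ d → Fin d → 𝔸ˣ) (Θ j) x ν‖ ≤ 2 * (((d : ℝ) * s) ^ 2 * M * ∑ i ∈ range j, ((L : ℝ) ^ 2) ^ i) :=
  norm_dcovF_le one_mem_U1Z (norm_carried_flat_le L hLs B hM0 Θ hΘ0 hΘs hM j) x ν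

end Carried

/-! ## §3 The canonical carried letter of the lineage at `U₀ = 1`, and the identity `L^jηQ_j(1)B = Ŷ_j + dΘ_j` -/

section Identity

variable {𝔸 : Type*} [NormedRing 𝔸] [NormedAlgebra ℂ 𝔸] [NormOneClass 𝔸] [CompleteSpace 𝔸] (L : ℕ)

/-- ★ **`Ŷ_j = linQIterZ L B j`**: the iterate of the gauge-corrected one-step linear parts `Q̂(Ū₀ʲ)` at the flat background IS print's straight iterate (127)∕(125) — `Q̂(1) = L·Q₀`
(`QhatZ_one_left`) at every level (`avgIterZ_one`). [cite: Balaban1985Averaging, (125) p.36, (127) p.37, p.38 (before (133))] -/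
theorem qhatIter_one_eq_linQIterZ (hL : 1 ≤ L) (B : SiteZ d → Fin d → 𝔸) :
    ∀ j : ℕ, qhatIter (fun _ A w κ => QhatZ L (1 : SiteZ d → Fin d → 𝔸ˣ) A ((L : ℤ) • w) κ) B j = linQIterZ L B j
  | 0 => rfl
  | j + 1 => by
    rw [qhatIter_succ, qhatIter_one_eq_linQIterZ hL B j]
    funext w κ
    rw [QhatZ_one_left L hL, linQIterZ_succ]

omit [NormOneClass 𝔸] [CompleteSpace 𝔸] in
/-- `Θ₀ = 0` for the canonical carried letter. [cite: Balaban1985Averaging, (93) p.31] -/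
theorem carryIter_one_zero (B : SiteZ d → Fin d → 𝔸) :
    carryIter (fun _ θ w => rlamZ L (1 : SiteZ d → Fin d → 𝔸ˣ) θ ((L : ℤ) • w))
      (fun _ A w => lamZ L (1 : SiteZ d → Fin d → 𝔸ˣ) A ((L : ℤ) • w)) (linQIterZ L B) 0 = 0 := rfl

omit [NormOneClass 𝔸] [CompleteSpace 𝔸] in
/-- **The canonical carried letter obeys §2's recursion**: `Θ_{j+1}(z) = (R̄Θ_j)(Lz) + Φ_{Ŷ_j}(Lz)` — at `V₀ = 1` the added letter `λ(1)` is the curvature functional `Φ` (`lamZ_one_left`).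
[cite: Balaban1985Averaging, (93) p.31, (112) p.34, (124) p.36; Balaban1987RG1, (0.4) p.253] -/
theorem carryIter_one_succ (B : SiteZ d → Fin d → 𝔸) (j : ℕ) (z : SiteZ d) :
    carryIter (fun _ θ w => rlamZ L (1 : SiteZ d → Fin d → 𝔸ˣ) θ ((L : ℤ) • w))
        (fun _ A w => lamZ L (1 : SiteZ d → Fin d → 𝔸ˣ) A ((L : ℤ) • w)) (linQIterZ L B) (j + 1) z
      = rlamZ L (1 : SiteZ d → Fin d → 𝔸ˣ)
          (carryIter (fun _ θ w => rlamZ L (1 : SiteZ d → Fin d → 𝔸ˣ) θ ((L : ℤ) • w))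
            (fun _ A w => lamZ L (1 : SiteZ d → Fin d → 𝔸ˣ) A ((L : ℤ) • w)) (linQIterZ L B) j) ((L : ℤ) • z)
        + PhiZ L (linQIterZ L B j) ((L : ℤ) • z) := by
  rw [carryIter_succ, Pi.add_apply, lamZ_one_left]

omit [NormOneClass 𝔸] in
/-- At the flat background the covariant coarse derivative of a rescaled site function is the plain difference on the next lattice:
`(d_1(f∘L·))(z, κ) = (d_{V̄}f)(⟨Lz, Lz + Le_κ⟩)` with `V̄ = 1̄ = 1`. [cite: Balaban1985Averaging, (43) p.24, (93) p.31] -/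
theorem dcovF_one_rescale (f : SiteZ d → 𝔸) (z : SiteZ d) (κ : Fin d) :
    dcovF (1 : SiteZ d → Fin d → 𝔸ˣ) (fun w => f ((L : ℤ) • w)) z κ = dcovZ L (1 : SiteZ d → Fin d → 𝔸ˣ) f ((L : ℤ) • z) κ := by
  have h := dcovF_succ_eq_dcovZ L (1 : SiteZ d → Fin d → 𝔸ˣ) 0 f z κ
  rwa [avgIterZ_one, avgIterZ_one] at h

/-- ★★★ **`L^jηQ_j(1)B = Ŷ_j + dΘ_j(B)` EXACTLY** — the record's linearised `j`-fold averaging operator at the flat background is print's straight iterate `linQIterZ L B j` PLUS the plain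
coarse gradient of the canonical carried letter `Θ_j(B)` (`B7Prop4GaugeInductionRec.linIter_eq_qhat_add_gauge` at `U₀ = 1`, with `Q̂(1) = L·Q₀`, `λ(1) = Φ`, `R̄(1) =` block mean, and the
pure-gauge identity `QhatZ_dcovF_add`).  This is the identity OF RECORD behind route (a) (director-ym №269 (1)) and the DO-NOT-REKEY rule (№269 (3)): the engine's `linCovIter_one_left ∕
map_linCovIter_flat` shape holds for `Ŷ_j`, for `linCovIterZ` only up to `dΘ_j`. [cite: Balaban1985Averaging, (93) p.31, (122)–(126) p.36, (127) p.37, p.38 (before (133));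
Balaban1987RG1, (0.4) p.253; Balaban1985RegularSpaces, (1.56)–(1.57) p.86] -/
theorem linCovIterZ_one_eq {s : ℕ} (hLs : L = 2 * s + 1) (B : SiteZ d → Fin d → 𝔸) (j : ℕ) (z : SiteZ d) (κ : Fin d) :
    linCovIterZ L (1 : SiteZ d → Fin d → 𝔸ˣ) B j z κ
      = linQIterZ L B j z κ
        + dcovF (1 : SiteZ d → Fin d → 𝔸ˣ)
            (carryIter (fun _ θ w => rlamZ L (1 : SiteZ d → Fin d → 𝔸ˣ) θ ((L : ℤ) • w))
              (fun _ A w => lamZ L (1 : SiteZ d → Fin d → 𝔸ˣ) A ((L : ℤ) • w)) (linQIterZ L B) j) z κ := by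
  have hL : 1 ≤ L := by omega
  have hW : ∀ (q : SiteZ d) (κ' : Fin d) (i : IdxZ d L), ‖((WZ L (1 : SiteZ d → Fin d → 𝔸ˣ) q κ' i : 𝔸ˣ) : 𝔸) - 1‖ < 1 := fun q κ' i => by
    simp [WZ_one]
  have h := linIter_eq_qhat_add_gauge (k := j)
    (fun _ A w κ' => QhatZ L (1 : SiteZ d → Fin d → 𝔸ˣ) A ((L : ℤ) • w) κ')
    (fun _ A w => lamZ L (1 : SiteZ d → Fin d → 𝔸ˣ) A ((L : ℤ) • w))
    (fun _ θ => dcovF (1 : SiteZ d → Fin d → 𝔸ˣ) θ)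
    (fun _ θ w => rlamZ L (1 : SiteZ d → Fin d → 𝔸ˣ) θ ((L : ℤ) • w))
    -- hQsub, hGsub, hDsub
    (fun _ _ A A' => funext fun w => funext fun κ' => QhatZ_sub L 1 A A' _ κ' (hW _ κ'))
    (fun _ _ A A' => funext fun w => lamZ_sub L 1 A A' _)
    (fun _ _ θ θ' => dcovF_sub 1 θ θ')
    -- hgauge: the pure-gauge identity at the flat background, read on the next lattice
    (fun _ _ θ => funext fun w => funext fun κ' => by
      show QhatZ L 1 (dcovF 1 θ) ((L : ℤ) • w) κ' + dcovF 1 (fun w' => lamZ L 1 (dcovF 1 θ) ((L : ℤ) • w')) w κ'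
        = dcovF 1 (fun w' => rlamZ L 1 θ ((L : ℤ) • w')) w κ'
      rw [dcovF_one_rescale, dcovF_one_rescale]
      exact QhatZ_dcovF_add L hL 1 θ _ κ' (hW _ κ'))
    B (linCovIterZ L 1 B) rfl
    (fun i _ => funext fun w => funext fun κ' => by
      show linCovIterZ L 1 B (i + 1) w κ' = QhatZ L 1 (linCovIterZ L 1 B i) ((L : ℤ) • w) κ'
        + dcovF 1 (fun w' => lamZ L 1 (linCovIterZ L 1 B i) ((L : ℤ) • w')) w κ'
      rw [linCovIterZ_succ, avgIterZ_one, dcovF_one_rescale, ← linQcovZ_eq_QhatZ_add_dcovZ])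
    j le_rfl
  have hq : qhatIter (fun _ A w κ' => QhatZ L (1 : SiteZ d → Fin d → 𝔸ˣ) A ((L : ℤ) • w) κ') B = linQIterZ L B :=
    funext (qhatIter_one_eq_linQIterZ L hL B)
  rw [hq] at h
  exact congrFun (congrFun h z) κ

/-- **The first level, in closed form**: `LηQ_1(1)B(z, κ) = L·(Q₀B)_c + Φ_B(c₋) − Φ_B(c₊)`, `c = ⟨Lz, Lz + Le_κ⟩` (`linQcovZ_one_left`): the record's one-step linear average differs from
print's straight average (125) by the coarse gradient of the curvature functional `Φ_B` — zero iff `Φ_B(c₋) = Φ_B(c₊)`, which fails for generic `B` (desk `LOCATED-N2-numeric.md`: d = 2,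
L = 3). [cite: Balaban1985Averaging, (122) p.36, (125) p.36; Balaban1987RG1, (0.4) p.253] -/
theorem linCovIterZ_one_one (hL : 1 ≤ L) (B : SiteZ d → Fin d → 𝔸) (z : SiteZ d) (κ : Fin d) :
    linCovIterZ L (1 : SiteZ d → Fin d → 𝔸ˣ) B 1 z κ
      = linQZ L B ((L : ℤ) • z) κ + PhiZ L B ((L : ℤ) • z) - PhiZ L B ((L : ℤ) • z + (L : ℤ) • e κ) := by
  rw [linCovIterZ_succ, avgIterZ_one, linCovIterZ_zero, linQcovZ_one_left L hL]

end Identity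

end Literature.MathematicalPhysics.QuantumFieldTheory.Balaban1983to89.B7Prop4FlatCarriedLetterRec
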